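import Mathlib
import Summits.Ventures.PercRepro.TriangleCapStarFamilyListGraph
import Summits.Ventures.PercRepro.TriangleCapStarFamilyOffDeg

/-!
# PercRepro — THE STAR FAMILY WITH A SHORT LIST: THE OFF-DEGREES (p3, gen 57; part 349)

`offDeg HSFL 0 v = offSFL v` for every `v < nSF` (`offDeg_HSFL`): a left vertex's off-degree in the bipartite part
is its class under `lfSF`, a right vertex's its class under `rfSFL` (parts 316 and 347), and the inside edges add
`a` at the centre and `1` at a special (`card_SSF_filter`, part 318).  Axioms: standard.
-/
namespace PercRepro

namespace TriangleCap

namespace C047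

open Finset

/-- The off-degree of a left vertex in the bipartite part is its class. -/
theorem offDeg_H0SFL_left (s ℓ t D a Rc : ℕ) (sh : ℕ → ℕ) (E Q : ℕ) (ha : 1 ≤ a) (hRc : 1 ≤ Rc) (hsh : ∀ ρ < Rc, sh ρ + 1 ≤ D)
    (hQ : 1 ≤ Q) (hQ1 : D ≤ Q + 1) (hQE : 1 ≤ E → D ≤ Q)
    (hinc : Rc * (D - 1) + (D - 1) * (D - a) + E * D = Q * D + ∑ ρ ∈ range Rc, sh ρ) (hℓ : a + Q + 1 ≤ ℓ)
    (hN : Rc + (D - 1) + E ≤ s - t) (v : ℕ) (hv : v < ℓ + 1) :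
    offDeg (H0SFL s ℓ t D a Rc sh E Q) (fin' (nSF s ℓ t) (nSF_pos s ℓ t) 0) (fin' (nSF s ℓ t) (nSF_pos s ℓ t) v) =
      cls (Rc + a * (D - 1) + Q * D) (lfSF D a Rc Q) v := by
  have hg := goodEnds_SFL (nSF s ℓ t) ℓ D a Rc sh E Q ha hRc hsh hQ hQ1 hQE hinc hℓ (by unfold nSF; omega)
  rw [offDeg_genWitness_left (nSF s ℓ t) (ℓ + 1) (s - a) (Rc + a * (D - 1) + Q * D) (nSF_pos s ℓ t)
    (lfSF D a Rc Q) (rfSFL ℓ D a Rc sh E) hg (by unfold nSF; omega) v hv]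
  rfl

/-- The off-degree of a right vertex in the bipartite part is its class. -/
theorem offDeg_H0SFL_right (s ℓ t D a Rc : ℕ) (sh : ℕ → ℕ) (E Q : ℕ) (ha : 1 ≤ a) (hRc : 1 ≤ Rc) (hsh : ∀ ρ < Rc, sh ρ + 1 ≤ D)
    (hQ : 1 ≤ Q) (hQ1 : D ≤ Q + 1) (hQE : 1 ≤ E → D ≤ Q)
    (hinc : Rc * (D - 1) + (D - 1) * (D - a) + E * D = Q * D + ∑ ρ ∈ range Rc, sh ρ) (hℓ : a + Q + 1 ≤ ℓ)
    (hN : Rc + (D - 1) + E ≤ s - t) (v : ℕ) (hv : ℓ + 1 ≤ v) (hvn : v < nSF s ℓ t) :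
    offDeg (H0SFL s ℓ t D a Rc sh E Q) (fin' (nSF s ℓ t) (nSF_pos s ℓ t) 0) (fin' (nSF s ℓ t) (nSF_pos s ℓ t) v) =
      cls (Rc + a * (D - 1) + Q * D) (rfSFL ℓ D a Rc sh E) v := by
  have hg := goodEnds_SFL (nSF s ℓ t) ℓ D a Rc sh E Q ha hRc hsh hQ hQ1 hQE hinc hℓ (by unfold nSF; omega)
  rw [offDeg_genWitness_right (nSF s ℓ t) (ℓ + 1) (s - a) (Rc + a * (D - 1) + Q * D) (nSF_pos s ℓ t)
    (lfSF D a Rc Q) (rfSFL ℓ D a Rc sh E) hg (by unfold nSF; omega) v hv hvn]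
  rfl

/-- **THE OFF-DEGREES OF THE STAR FAMILY:** `offDeg HSFL 0 v = offSFL v` for `v < n`. -/
theorem offDeg_HSFL (s ℓ t D a Rc : ℕ) (sh : ℕ → ℕ) (E Q : ℕ) (ha : 1 ≤ a) (hRc : 1 ≤ Rc) (hsh : ∀ ρ < Rc, sh ρ + 1 ≤ D)
    (hQ : 1 ≤ Q) (hQ1 : D ≤ Q + 1) (hQE : 1 ≤ E → D ≤ Q)
    (hinc : Rc * (D - 1) + (D - 1) * (D - a) + E * D = Q * D + ∑ ρ ∈ range Rc, sh ρ) (hℓ : a + Q + 1 ≤ ℓ)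
    (hN : Rc + (D - 1) + E ≤ s - t) (v : ℕ) (hv : v < nSF s ℓ t) :
    offDeg (HSFL s ℓ t D a Rc sh E Q) (fin' (nSF s ℓ t) (nSF_pos s ℓ t) 0) (fin' (nSF s ℓ t) (nSF_pos s ℓ t) v) =
      offSFL ℓ D a Rc sh E Q v := by
  have hD1 : 1 ≤ D := by
    have := hsh 0 (by omega)
    omega
  rw [offDeg_addEdges _ _ (SSF_nondiag s ℓ t a Q hℓ) (SSFL_new s ℓ t D a Rc sh E Q hℓ) _
    (SSF_zero s ℓ t a Q hℓ), card_SSF_filter s ℓ t a Q v hℓ hv]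
  rcases Nat.eq_zero_or_pos v with rfl | hv1
  · rw [offDeg_self]
    unfold offSFL
    rw [if_pos rfl, if_neg (show ¬ (0 = a + Q + 1) by omega), if_neg (show ¬ (1 ≤ 0 ∧ 0 ≤ a) by omega)]
  by_cases hva : v ≤ a
  · obtain ⟨c, rfl⟩ : ∃ c, v = 1 + c := ⟨v - 1, by omega⟩
    rw [offDeg_H0SFL_left s ℓ t D a Rc sh E Q ha hRc hsh hQ hQ1 hQE hinc hℓ hN (1 + c) (by omega),
      cls_lfSF_special D a Rc Q c ha hQ (by omega)]
    unfold offSFL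
    split_ifs <;> omega
  by_cases hvq : v ≤ a + Q
  · obtain ⟨q, rfl⟩ : ∃ q, v = a + 1 + q := ⟨v - a - 1, by omega⟩
    rw [offDeg_H0SFL_left s ℓ t D a Rc sh E Q ha hRc hsh hQ hQ1 hQE hinc hℓ hN (a + 1 + q) (by omega),
      cls_lfSF_regular D a Rc Q q ha hQ (by omega)]
    unfold offSFL
    split_ifs <;> omega
  by_cases hvc : v = a + Q + 1
  · subst hvc
    rw [offDeg_H0SFL_left s ℓ t D a Rc sh E Q ha hRc hsh hQ hQ1 hQE hinc hℓ hN (a + Q + 1) (by omega),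
      cls_lfSF_centre D a Rc Q ha hQ, if_pos rfl]
    unfold offSFL
    rw [if_neg (show ¬ (a + Q + 1 = 0) by omega), if_neg (show ¬ (a + Q + 1 ≤ a) by omega),
      if_neg (show ¬ (a + Q + 1 ≤ a + Q) by omega), if_pos rfl]
  by_cases hvℓ : v ≤ ℓ
  · rw [offDeg_H0SFL_left s ℓ t D a Rc sh E Q ha hRc hsh hQ hQ1 hQE hinc hℓ hN v (by omega),
      cls_lfSF_zero D a Rc Q v ha hQ (Or.inr (by omega))]
    unfold offSFL
    split_ifs <;> omega
  rw [offDeg_H0SFL_right s ℓ t D a Rc sh E Q ha hRc hsh hQ hQ1 hQE hinc hℓ hN v (by omega) hv]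
  by_cases hv2 : v < ℓ + 1 + Rc
  · obtain ⟨ρ, rfl⟩ : ∃ ρ, v = ℓ + 1 + ρ := ⟨v - (ℓ + 1), by omega⟩
    rw [cls_rfSFL_centre_row ℓ D a Rc sh E Q ρ hRc hsh hinc (by omega)]
    unfold offSFL
    rw [Nat.add_sub_cancel_left]
    split_ifs <;> omega
  by_cases hv3 : v < ℓ + 1 + Rc + (D - 1)
  · obtain ⟨ρ', rfl⟩ : ∃ ρ', v = ℓ + 1 + Rc + ρ' := ⟨v - (ℓ + 1 + Rc), by omega⟩
    rw [cls_rfSFL_outer_row ℓ D a Rc sh E Q ρ' ha hRc hsh hinc (by omega)]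
    unfold offSFL
    have e : ℓ + 1 + Rc + ρ' - (ℓ + 1) = Rc + ρ' := by omega
    rw [e]
    split_ifs <;> omega
  by_cases hv4 : v < ℓ + 1 + (Rc + (D - 1) + E)
  · obtain ⟨e, rfl⟩ : ∃ e, v = ℓ + 1 + (Rc + (D - 1) + e) := ⟨v - (ℓ + 1 + Rc + (D - 1)), by omega⟩
    rw [cls_rfSFL_extra_row ℓ D a Rc sh E Q e ha hRc hsh hinc (by omega)]
    unfold offSFL
    split_ifs <;> omega
  rw [cls_rfSFL_zero ℓ D a Rc sh E Q v ha hRc hsh hinc (Or.inr (by omega))]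
  unfold offSFL
  split_ifs <;> omega

end C047

end TriangleCap

end PercRepro
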